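import Mathlib
import Literature.NumberTheory.LFunctions.Zhang2022.ToolkitDivisorMajorants
import HarnessLib

/-!
# Zhang (2022) §17.u007 ("a detailed analysis shows …"), the engine: an exact expansion in the ring of
# arithmetic functions and its divisor-function majorant

Topic `Literature/NumberTheory/LFunctions/Zhang2022` (Landau–Siegel audit tree; verdict-neutral).
Y. Zhang, *Discrete mean estimates and the Landau–Siegel zero*, arXiv:2211.02515v1 (2022)
[Zhang2022LandauSiegel] — **an unrefereed manuscript under adjudication**; nothing here asserts or
denies its Theorems 1–2. DAG node `Z22:§17.u007` [Z22 p.96, tex L4735–L4747]: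

> "A detailed analysis shows that (17.2) [sc. (17.3)] remains valid if, in the expression for `ν*(n)`,
> the factor `κ₂(n₁)` is replaced by `(1∗μ)(n₁)`, the factor `χ(n₂n₃)(ϰ₁(n₂)+ι₂ϰ₂(n₂))(ῑ₃ϰ₃(n₃)+ῑ₄ϰ₄(n₃))`
> is replaced by `𝔢₀χ(n₂n₃)` with (17.4), and the factors `g̃₂(n₅)` and `g̃₃(n₆)` are replaced by `1`
> respectively."

The analysis is not carried out in print. This file supplies its ALGEBRAIC CORE, for arbitrary data
(theorems only; no definitions, no named facts): in the commutative ring of arithmetic functions, with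
`Z = ζ`, `M = μ` (`ZM = 1`), three "shift" factors `E_i = Z + Δ_i`, the `χ`-twists `XZ = χ`,
`XM = χμ` (`XZ·XM = 1`) and `XA_j = c_j·XZ + XR_j` (`j = 1, 2`), the coefficient sequence of §17.u006
below `D⁴` is `P = E₁E₂E₃M²·XA₁XA₂XM` and

* `expansion` — `P − c₁c₂·(Z·XZ) = c₁c₂(S₁ + S₂M + S₃M²)XZ + c₁Q·XR₂ + c₂Q·XR₁ + Q·XR₁XR₂XM`,
  `S₁ = ΣΔ_i`, `S₂ = Σ_{i<j}Δ_iΔ_j`, `S₃ = Δ₁Δ₂Δ₃`, `Q = Z + S₁ + S₂M + S₃M²` (exact; uses only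
  `ZM = 1`, `XZ·XM = 1` — the cancellations `1∗μ = δ`, `χ∗χμ = δ` that keep the low-order terms
  SHORT convolutions, which is what makes the "detailed analysis" elementary);
* `norm_mul_apply_le_of_lt` — divisor-type majorants multiply under Dirichlet convolution, LOCALLY:
  bounds on `[1, N)` for the factors give bounds on `[1, N)` for the product;
* `norm_error_le` — hence, if on `1 ≤ m < N` the four unit factors are bounded by `1`, `|Δ_i| ≤ η` and
  `|XR_j| ≤ C_jη`, then for `1 ≤ n < N`
  `|P(n) − c₁c₂(Z·XZ)(n)| ≤ |c₁c₂|(3ητ₂+3η²τ₄+η³τ₆)(n) + (|c₁|C₂+|c₂|C₁)η(τ₂+3ητ₂+3η²τ₄+η³τ₆)(n)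
   + C₁C₂η²(τ₄+3ητ₄+3η²τ₆+η³τ₈)(n)` (`τ_j` = the tree's `MeanSquareMajorant.tau j = ζ^j`);
* `tau_mul_tau_two_le`, `sum_tau_mul_norm_le` — `τ_j(n)τ₂(n) ≤ τ_{2j}(n)` (sub-multiplicativity
  `MeanSquareMajorant.tau_mul_le`) and hence, for any `ν` with `|ν| ≤ τ₂`,
  `Σ_{n<x} τ_j(n)|ν(n)|/n ≤ (1 + log x)^{2j}` (`sum_tau_div_Icc_le_log_pow`).

At the manuscript's data (`Section17Step17u007`): `N = D⁴`, `η ≍ 𝓛⁻⁸`, `x = D⁴`, so the error in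
`Σ_{n<D⁴}ν*(n)ν(n)/n` is `O(η𝓛⁴ + η²𝓛⁸ + … + η⁵𝓛¹⁶) = O(𝓛⁻⁴)` — the orders must be kept SEPARATE
(lumping `τ₄ ≤ τ₈` would give `η²𝓛¹⁶ = O(1)`). ZHANG-L discharge lane (WP16, seat zl-w16-p6), toward
the leaf `Typed.Section17.Eq17_6Rel` via `Typed.Section17.eq17_6Rel_of_step17_u007` (`Section17Eq172`).
WHAT THIS IS NOT: a claim about §17.u007 at the manuscript's data (the companion files), about
Theorems 1–2 of the source, or about Landau–Siegel zeros.

## References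

* Y. Zhang, arXiv:2211.02515v1 (2022), §17 u006–u008, (17.3)–(17.5) p.96 (tex L4728–L4750).
  [cite: Zhang2022LandauSiegel, §17 u007 p.96]
* A. Ivić, *The Riemann Zeta-Function* (1985), §1.6 (the divisor functions `d_k`).
  [cite: Ivic1985, §1.6 (1.68)–(1.70)]
-/

noncomputable section

open Finset ArithmeticFunction
open Literature.NumberTheory.LFunctions.Zhang2022.MeanSquareMajorant

namespace Literature.NumberTheory.LFunctions.Zhang2022.U007

/-! ## The exact expansion -/

/-- **The expansion of §17.u007** in a commutative `ℂ`-algebra (used in `ArithmeticFunction ℂ`): with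
`ZM = 1` and `XZ·XM = 1`,
`(Z+Δ₁)(Z+Δ₂)(Z+Δ₃)M²·(c₁XZ+XR₁)(c₂XZ+XR₂)XM − c₁c₂·Z·XZ
 = c₁c₂(S₁+S₂M+S₃M²)XZ + c₁Q·XR₂ + c₂Q·XR₁ + Q·XR₁XR₂XM`, `Q = Z + S₁ + S₂M + S₃M²`.
[cite: Zhang2022LandauSiegel, §17 u007 p.96] -/
theorem expansion {A : Type*} [CommRing A] [Algebra ℂ A] (Z M Δ₁ Δ₂ Δ₃ XZ XM XR₁ XR₂ : A) (c₁ c₂ : ℂ)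
    (hZM : Z * M = 1) (hX : XZ * XM = 1) :
    (Z + Δ₁) * (Z + Δ₂) * (Z + Δ₃) * M * M * ((c₁ • XZ + XR₁) * (c₂ • XZ + XR₂) * XM) -
        (c₁ * c₂) • (Z * XZ) =
      (c₁ * c₂) • (((Δ₁ + Δ₂ + Δ₃) + (Δ₁ * Δ₂ + Δ₁ * Δ₃ + Δ₂ * Δ₃) * M + Δ₁ * Δ₂ * Δ₃ * M * M) * XZ) +
      c₁ • ((Z + (Δ₁ + Δ₂ + Δ₃) + (Δ₁ * Δ₂ + Δ₁ * Δ₃ + Δ₂ * Δ₃) * M + Δ₁ * Δ₂ * Δ₃ * M * M) * XR₂) +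
      c₂ • ((Z + (Δ₁ + Δ₂ + Δ₃) + (Δ₁ * Δ₂ + Δ₁ * Δ₃ + Δ₂ * Δ₃) * M + Δ₁ * Δ₂ * Δ₃ * M * M) * XR₁) +
      (Z + (Δ₁ + Δ₂ + Δ₃) + (Δ₁ * Δ₂ + Δ₁ * Δ₃ + Δ₂ * Δ₃) * M + Δ₁ * Δ₂ * Δ₃ * M * M) *
        (XR₁ * XR₂ * XM) := by
  -- the untwisted block: `(Z+Δ₁)(Z+Δ₂)(Z+Δ₃)M² = Z + S₁ + S₂M + S₃M²`
  have h3 : Z * Z * Z * M * M = Z := by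
    calc Z * Z * Z * M * M = Z * (Z * M) * (Z * M) := by ring
      _ = Z := by rw [hZM]; ring
  have h2 : Z * Z * M * M = 1 := by
    calc Z * Z * M * M = (Z * M) * (Z * M) := by ring
      _ = 1 := by rw [hZM]; ring
  have h1 : Z * M * M = M := by rw [hZM]; ring
  have hP1 : (Z + Δ₁) * (Z + Δ₂) * (Z + Δ₃) * M * M =
      Z + (Δ₁ + Δ₂ + Δ₃) + (Δ₁ * Δ₂ + Δ₁ * Δ₃ + Δ₂ * Δ₃) * M + Δ₁ * Δ₂ * Δ₃ * M * M := by
    linear_combination h3 + (Δ₁ + Δ₂ + Δ₃) * h2 + (Δ₁ * Δ₂ + Δ₁ * Δ₃ + Δ₂ * Δ₃) * h1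
  -- the twisted block: `(c₁XZ+XR₁)(c₂XZ+XR₂)XM = c₁c₂XZ + c₁XR₂ + c₂XR₁ + XR₁XR₂XM`
  have k2 : XZ * XZ * XM = XZ := by
    calc XZ * XZ * XM = XZ * (XZ * XM) := by ring
      _ = XZ := by rw [hX]; ring
  have hP2 : (c₁ • XZ + XR₁) * (c₂ • XZ + XR₂) * XM =
      (c₁ * c₂) • XZ + c₁ • XR₂ + c₂ • XR₁ + XR₁ * XR₂ * XM := by
    simp only [Algebra.smul_def, map_mul]
    linear_combination (algebraMap ℂ A c₁ * algebraMap ℂ A c₂) * k2 +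
      (algebraMap ℂ A c₁ * XR₂ + algebraMap ℂ A c₂ * XR₁) * hX
  rw [hP1, hP2]
  simp only [Algebra.smul_def, map_mul]
  ring

/-! ## Divisor-type majorants, locally on `[1, N)` -/

/-- **Majorants multiply under Dirichlet convolution, locally**: if `|F(m)| ≤ f(m)` and `|G(m)| ≤ g(m)`
for `1 ≤ m < N`, with `f, g ≥ 0`, then `|(F∗G)(n)| ≤ (f∗g)(n)` for `1 ≤ n < N` (the divisors of
`n < N` are `< N`). [cite: Ivic1985, §1.6 p. 31] -/
theorem norm_mul_apply_le_of_lt {N : ℕ} {F G : ArithmeticFunction ℂ} {f g : ArithmeticFunction ℝ}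
    (hf0 : ∀ m, 0 ≤ f m)
    (hF : ∀ m : ℕ, m ≠ 0 → m < N → ‖F m‖ ≤ f m) (hG : ∀ m : ℕ, m ≠ 0 → m < N → ‖G m‖ ≤ g m) :
    ∀ n : ℕ, n ≠ 0 → n < N → ‖(F * G) n‖ ≤ (f * g) n := by
  intro n hn0 hn
  rw [mul_apply, mul_apply]
  refine (norm_sum_le _ _).trans (sum_le_sum fun x hx => ?_)
  obtain ⟨hxn, -⟩ := Nat.mem_divisorsAntidiagonal.mp hx
  have h1 : x.1 ≠ 0 := by rintro h; rw [h, zero_mul] at hxn; exact hn0 hxn.symm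
  have h2 : x.2 ≠ 0 := by rintro h; rw [h, mul_zero] at hxn; exact hn0 hxn.symm
  have hx1 : x.1 < N := lt_of_le_of_lt
    (by rw [← hxn]; exact Nat.le_mul_of_pos_right _ (Nat.pos_of_ne_zero h2)) hn
  have hx2 : x.2 < N := lt_of_le_of_lt
    (by rw [← hxn]; exact Nat.le_mul_of_pos_left _ (Nat.pos_of_ne_zero h1)) hn
  rw [norm_mul]
  exact mul_le_mul (hF _ h1 hx1) (hG _ h2 hx2) (norm_nonneg _) (hf0 _)

/-- Sums: `|(F+G)(m)| ≤ f(m) + g(m)` on `[1, N)`. [folklore] -/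
private theorem norm_add_apply_le_of_lt {N : ℕ} {F G : ArithmeticFunction ℂ} {f g : ArithmeticFunction ℝ}
    (hF : ∀ m : ℕ, m ≠ 0 → m < N → ‖F m‖ ≤ f m) (hG : ∀ m : ℕ, m ≠ 0 → m < N → ‖G m‖ ≤ g m) :
    ∀ n : ℕ, n ≠ 0 → n < N → ‖(F + G) n‖ ≤ (f + g) n := fun n hn0 hn => by
  rw [ArithmeticFunction.add_apply, ArithmeticFunction.add_apply]
  exact (norm_add_le _ _).trans (add_le_add (hF n hn0 hn) (hG n hn0 hn))

/-- Scalars: `|(c•F)(m)| ≤ |c|·f(m)` on `[1, N)`. [folklore] -/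
private theorem norm_smul_apply_le_of_lt {N : ℕ} {F : ArithmeticFunction ℂ} {f : ArithmeticFunction ℝ}
    (c : ℂ) (hF : ∀ m : ℕ, m ≠ 0 → m < N → ‖F m‖ ≤ f m) :
    ∀ n : ℕ, n ≠ 0 → n < N → ‖(c • F) n‖ ≤ (‖c‖ • f) n := fun n hn0 hn => by
  have h1 : (c • F) n = c * F n := by simp
  have h2 : (‖c‖ • f) n = ‖c‖ * f n := by simp
  rw [h1, h2, norm_mul]
  exact mul_le_mul_of_nonneg_left (hF n hn0 hn) (norm_nonneg _)

/-- `τ_{a+b} = τ_a ∗ τ_b` in the ring of real arithmetic functions (`τ_j = ζ^j`). [cite: Ivic1985, §1.6 (1.68)] -/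
theorem tau_add (a b : ℕ) : tau (a + b) = tau a * tau b := by
  unfold tau; rw [pow_add]

/-- `τ`-polynomials with non-negative coefficients are non-negative. [folklore] -/
private theorem tau_poly_nonneg {a₁ a₂ a₃ a₄ : ℝ} {j₁ j₂ j₃ j₄ : ℕ} (h₁ : 0 ≤ a₁) (h₂ : 0 ≤ a₂)
    (h₃ : 0 ≤ a₃) (h₄ : 0 ≤ a₄) (m : ℕ) :
    0 ≤ (a₁ • tau j₁ + a₂ • tau j₂ + a₃ • tau j₃ + a₄ • tau j₄) m := by
  have e : (a₁ • tau j₁ + a₂ • tau j₂ + a₃ • tau j₃ + a₄ • tau j₄) m =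
      a₁ * tau j₁ m + a₂ * tau j₂ m + a₃ * tau j₃ m + a₄ * tau j₄ m := by simp
  rw [e]
  have := tau_nonneg j₁ m; have := tau_nonneg j₂ m; have := tau_nonneg j₃ m; have := tau_nonneg j₄ m
  positivity

/-! ## The majorant of the error -/

/-- **The error of §17.u007 is majorised by a `τ`-polynomial.** In `ArithmeticFunction ℂ`, let
`ZM = 1`, `XZ·XM = 1`, and on `1 ≤ m < N`: `|Z|, |M|, |XZ|, |XM| ≤ 1`, `|Δ_i| ≤ η` (`i = 1,2,3`),
`|XR_j| ≤ C_jη` (`η, C_j ≥ 0`). Then for `1 ≤ n < N`,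
`|(E₁E₂E₃M²·XA₁XA₂XM)(n) − c₁c₂(Z·XZ)(n)| ≤ |c₁c₂|(3ητ₂+3η²τ₄+η³τ₆)(n)
 + (|c₁|C₂+|c₂|C₁)η(τ₂+3ητ₂+3η²τ₄+η³τ₆)(n) + C₁C₂η²(τ₄+3ητ₄+3η²τ₆+η³τ₈)(n)`
(`E_i = Z+Δ_i`, `XA_j = c_jXZ + XR_j`). [cite: Zhang2022LandauSiegel, §17 u007 p.96] -/
theorem norm_error_le {N : ℕ} (Z M Δ₁ Δ₂ Δ₃ XZ XM XR₁ XR₂ : ArithmeticFunction ℂ) (c₁ c₂ : ℂ)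
    {η C₁ C₂ : ℝ} (hη : 0 ≤ η) (hC₁ : 0 ≤ C₁) (hC₂ : 0 ≤ C₂)
    (hZM : Z * M = 1) (hX : XZ * XM = 1)
    (hZ : ∀ m : ℕ, m ≠ 0 → m < N → ‖Z m‖ ≤ 1) (hM : ∀ m : ℕ, m ≠ 0 → m < N → ‖M m‖ ≤ 1)
    (hXZ : ∀ m : ℕ, m ≠ 0 → m < N → ‖XZ m‖ ≤ 1) (hXM : ∀ m : ℕ, m ≠ 0 → m < N → ‖XM m‖ ≤ 1)
    (hΔ₁ : ∀ m : ℕ, m ≠ 0 → m < N → ‖Δ₁ m‖ ≤ η) (hΔ₂ : ∀ m : ℕ, m ≠ 0 → m < N → ‖Δ₂ m‖ ≤ η)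
    (hΔ₃ : ∀ m : ℕ, m ≠ 0 → m < N → ‖Δ₃ m‖ ≤ η)
    (hR₁ : ∀ m : ℕ, m ≠ 0 → m < N → ‖XR₁ m‖ ≤ C₁ * η)
    (hR₂ : ∀ m : ℕ, m ≠ 0 → m < N → ‖XR₂ m‖ ≤ C₂ * η) :
    ∀ n : ℕ, n ≠ 0 → n < N →
      ‖((Z + Δ₁) * (Z + Δ₂) * (Z + Δ₃) * M * M * ((c₁ • XZ + XR₁) * (c₂ • XZ + XR₂) * XM) -
          (c₁ * c₂) • (Z * XZ)) n‖ ≤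
        ‖c₁ * c₂‖ * (3 * η * tau 2 n + 3 * η ^ 2 * tau 4 n + η ^ 3 * tau 6 n) +
        (‖c₁‖ * C₂ + ‖c₂‖ * C₁) * η *
          (tau 2 n + 3 * η * tau 2 n + 3 * η ^ 2 * tau 4 n + η ^ 3 * tau 6 n) +
        C₁ * C₂ * η ^ 2 * (tau 4 n + 3 * η * tau 4 n + 3 * η ^ 2 * tau 6 n + η ^ 3 * tau 8 n) := by
  intro n hn0 hn
  rw [expansion Z M Δ₁ Δ₂ Δ₃ XZ XM XR₁ XR₂ c₁ c₂ hZM hX]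
  -- majorants of the unit factors: `τ₁`
  have ht1 : ∀ m : ℕ, m ≠ 0 → tau 1 m = 1 := fun m hm => tau_one_apply hm
  have unitZ : ∀ m : ℕ, m ≠ 0 → m < N → ‖Z m‖ ≤ tau 1 m := fun m hm hmN => by rw [ht1 m hm]; exact hZ m hm hmN
  have unitM : ∀ m : ℕ, m ≠ 0 → m < N → ‖M m‖ ≤ tau 1 m := fun m hm hmN => by rw [ht1 m hm]; exact hM m hm hmN
  have unitXZ : ∀ m : ℕ, m ≠ 0 → m < N → ‖XZ m‖ ≤ tau 1 m := fun m hm hmN => by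
    rw [ht1 m hm]; exact hXZ m hm hmN
  have unitXM : ∀ m : ℕ, m ≠ 0 → m < N → ‖XM m‖ ≤ tau 1 m := fun m hm hmN => by
    rw [ht1 m hm]; exact hXM m hm hmN
  have smΔ₁ : ∀ m : ℕ, m ≠ 0 → m < N → ‖Δ₁ m‖ ≤ (η • tau 1) m := fun m hm hmN => by
    rw [show (η • tau 1) m = η * tau 1 m by simp, ht1 m hm, mul_one]; exact hΔ₁ m hm hmN
  have smΔ₂ : ∀ m : ℕ, m ≠ 0 → m < N → ‖Δ₂ m‖ ≤ (η • tau 1) m := fun m hm hmN => by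
    rw [show (η • tau 1) m = η * tau 1 m by simp, ht1 m hm, mul_one]; exact hΔ₂ m hm hmN
  have smΔ₃ : ∀ m : ℕ, m ≠ 0 → m < N → ‖Δ₃ m‖ ≤ (η • tau 1) m := fun m hm hmN => by
    rw [show (η • tau 1) m = η * tau 1 m by simp, ht1 m hm, mul_one]; exact hΔ₃ m hm hmN
  have smR₁ : ∀ m : ℕ, m ≠ 0 → m < N → ‖XR₁ m‖ ≤ ((C₁ * η) • tau 1) m := fun m hm hmN => by
    rw [show ((C₁ * η) • tau 1) m = C₁ * η * tau 1 m by simp, ht1 m hm, mul_one]; exact hR₁ m hm hmN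
  have smR₂ : ∀ m : ℕ, m ≠ 0 → m < N → ‖XR₂ m‖ ≤ ((C₂ * η) • tau 1) m := fun m hm hmN => by
    rw [show ((C₂ * η) • tau 1) m = C₂ * η * tau 1 m by simp, ht1 m hm, mul_one]; exact hR₂ m hm hmN
  -- non-negativity of the basic majorants
  have t0 : ∀ j m, 0 ≤ tau j m := tau_nonneg
  have n1 : ∀ m, 0 ≤ (tau 1) m := t0 1
  have nη : ∀ m, 0 ≤ (η • tau 1) m := fun m => by
    rw [show (η • tau 1) m = η * tau 1 m by simp]; exact mul_nonneg hη (t0 1 m)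
  have nR₁ : ∀ m, 0 ≤ ((C₁ * η) • tau 1) m := fun m => by
    rw [show ((C₁ * η) • tau 1) m = C₁ * η * tau 1 m by simp]; exact mul_nonneg (mul_nonneg hC₁ hη) (t0 1 m)
  have nR₂ : ∀ m, 0 ≤ ((C₂ * η) • tau 1) m := fun m => by
    rw [show ((C₂ * η) • tau 1) m = C₂ * η * tau 1 m by simp]; exact mul_nonneg (mul_nonneg hC₂ hη) (t0 1 m)
  have nmul : ∀ {f g : ArithmeticFunction ℝ}, (∀ m, 0 ≤ f m) → (∀ m, 0 ≤ g m) → ∀ m, 0 ≤ (f * g) m := by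
    intro f g hf hg m
    rw [mul_apply]; exact sum_nonneg fun x _ => mul_nonneg (hf _) (hg _)
  have nadd : ∀ {f g : ArithmeticFunction ℝ}, (∀ m, 0 ≤ f m) → (∀ m, 0 ≤ g m) → ∀ m, 0 ≤ (f + g) m := by
    intro f g hf hg m; rw [ArithmeticFunction.add_apply]; exact add_nonneg (hf m) (hg m)
  -- S₁, S₂ M, S₃ M M
  have hS₁ := norm_add_apply_le_of_lt (norm_add_apply_le_of_lt smΔ₁ smΔ₂) smΔ₃
  have hS₂M : ∀ m : ℕ, m ≠ 0 → m < N →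
      ‖((Δ₁ * Δ₂ + Δ₁ * Δ₃ + Δ₂ * Δ₃) * M) m‖ ≤
        ((η • tau 1 * (η • tau 1) + η • tau 1 * (η • tau 1) + η • tau 1 * (η • tau 1)) * tau 1) m := by
    have h12 := norm_mul_apply_le_of_lt nη smΔ₁ smΔ₂
    have h13 := norm_mul_apply_le_of_lt nη smΔ₁ smΔ₃
    have h23 := norm_mul_apply_le_of_lt nη smΔ₂ smΔ₃
    have hsum := norm_add_apply_le_of_lt (norm_add_apply_le_of_lt h12 h13) h23
    exact norm_mul_apply_le_of_lt (nadd (nadd (nmul nη nη) (nmul nη nη)) (nmul nη nη)) hsum unitM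
  have hS₃MM : ∀ m : ℕ, m ≠ 0 → m < N →
      ‖(Δ₁ * Δ₂ * Δ₃ * M * M) m‖ ≤ (η • tau 1 * (η • tau 1) * (η • tau 1) * tau 1 * tau 1) m := by
    have h12 := norm_mul_apply_le_of_lt nη smΔ₁ smΔ₂
    have h123 := norm_mul_apply_le_of_lt (nmul nη nη) h12 smΔ₃
    have h4 := norm_mul_apply_le_of_lt (nmul (nmul nη nη) nη) h123 unitM
    exact norm_mul_apply_le_of_lt (nmul (nmul (nmul nη nη) nη) n1) h4 unitM
  -- the short block Q − Z and Q
  set q' : ArithmeticFunction ℝ := (η • tau 1 + η • tau 1 + η • tau 1) +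
    (η • tau 1 * (η • tau 1) + η • tau 1 * (η • tau 1) + η • tau 1 * (η • tau 1)) * tau 1 +
    η • tau 1 * (η • tau 1) * (η • tau 1) * tau 1 * tau 1 with hq'
  set q : ArithmeticFunction ℝ := tau 1 + (η • tau 1 + η • tau 1 + η • tau 1) +
    (η • tau 1 * (η • tau 1) + η • tau 1 * (η • tau 1) + η • tau 1 * (η • tau 1)) * tau 1 +
    η • tau 1 * (η • tau 1) * (η • tau 1) * tau 1 * tau 1 with hq
  have nq'parts1 : ∀ m, 0 ≤ (η • tau 1 + η • tau 1 + η • tau 1) m := nadd (nadd nη nη) nη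
  have nq'parts2 : ∀ m, 0 ≤ ((η • tau 1 * (η • tau 1) + η • tau 1 * (η • tau 1) +
      η • tau 1 * (η • tau 1)) * tau 1) m :=
    nmul (nadd (nadd (nmul nη nη) (nmul nη nη)) (nmul nη nη)) n1
  have nq'parts3 : ∀ m, 0 ≤ (η • tau 1 * (η • tau 1) * (η • tau 1) * tau 1 * tau 1) m :=
    nmul (nmul (nmul (nmul nη nη) nη) n1) n1
  have nq' : ∀ m, 0 ≤ q' m := nadd (nadd nq'parts1 nq'parts2) nq'parts3
  have nq : ∀ m, 0 ≤ q m := nadd (nadd (nadd n1 nq'parts1) nq'parts2) nq'parts3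
  have hQZ : ∀ m : ℕ, m ≠ 0 → m < N →
      ‖((Δ₁ + Δ₂ + Δ₃) + (Δ₁ * Δ₂ + Δ₁ * Δ₃ + Δ₂ * Δ₃) * M + Δ₁ * Δ₂ * Δ₃ * M * M) m‖ ≤ q' m :=
    norm_add_apply_le_of_lt (norm_add_apply_le_of_lt hS₁ hS₂M) hS₃MM
  have hQ : ∀ m : ℕ, m ≠ 0 → m < N →
      ‖(Z + (Δ₁ + Δ₂ + Δ₃) + (Δ₁ * Δ₂ + Δ₁ * Δ₃ + Δ₂ * Δ₃) * M + Δ₁ * Δ₂ * Δ₃ * M * M) m‖ ≤ q m :=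
    norm_add_apply_le_of_lt (norm_add_apply_le_of_lt (norm_add_apply_le_of_lt unitZ hS₁) hS₂M) hS₃MM
  -- the four groups
  have g1 := norm_smul_apply_le_of_lt (c₁ * c₂) (norm_mul_apply_le_of_lt nq' hQZ unitXZ)
  have g2 := norm_smul_apply_le_of_lt c₁ (norm_mul_apply_le_of_lt nq hQ smR₂)
  have g3 := norm_smul_apply_le_of_lt c₂ (norm_mul_apply_le_of_lt nq hQ smR₁)
  have hRRM := norm_mul_apply_le_of_lt (nmul nR₁ nR₂) (norm_mul_apply_le_of_lt nR₁ smR₁ smR₂) unitXM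
  have g4 := norm_mul_apply_le_of_lt nq hQ hRRM
  have total := norm_add_apply_le_of_lt (norm_add_apply_le_of_lt (norm_add_apply_le_of_lt g1 g2) g3) g4
    n hn0 hn
  refine total.trans (le_of_eq ?_)
  -- evaluate the τ-polynomial: first as an identity in the ring of real arithmetic functions
  have e2 : tau 1 * tau 1 = tau 2 := (tau_add 1 1).symm
  have e4 : tau 1 * tau 1 * tau 1 * tau 1 = tau 4 := by rw [e2, ← tau_add, ← tau_add]
  have e6 : tau 1 * tau 1 * tau 1 * tau 1 * tau 1 * tau 1 = tau 6 := by
    rw [e4, ← tau_add, ← tau_add]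
  have e8 : tau 1 * tau 1 * tau 1 * tau 1 * tau 1 * tau 1 * tau 1 * tau 1 = tau 8 := by
    rw [e6, ← tau_add, ← tau_add]
  have hpoly : (‖c₁ * c₂‖ • (q' * tau 1) + ‖c₁‖ • (q * ((C₂ * η) • tau 1)) +
      ‖c₂‖ • (q * ((C₁ * η) • tau 1)) + q * ((C₁ * η) • tau 1 * ((C₂ * η) • tau 1) * tau 1)) =
      (‖c₁ * c₂‖ * (3 * η) + (‖c₁‖ * C₂ + ‖c₂‖ * C₁) * η * (1 + 3 * η)) • tau 2 +
      (‖c₁ * c₂‖ * (3 * η ^ 2) + (‖c₁‖ * C₂ + ‖c₂‖ * C₁) * η * (3 * η ^ 2) +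
        C₁ * C₂ * η ^ 2 * (1 + 3 * η)) • tau 4 +
      (‖c₁ * c₂‖ * η ^ 3 + (‖c₁‖ * C₂ + ‖c₂‖ * C₁) * η * η ^ 3 + C₁ * C₂ * η ^ 2 * (3 * η ^ 2)) • tau 6 +
      (C₁ * C₂ * η ^ 2 * η ^ 3) • tau 8 := by
    rw [hq, hq', ← e2, ← e4, ← e6, ← e8]
    simp only [Algebra.smul_def, map_mul, map_add, map_pow, map_one, map_ofNat]
    ring
  rw [hpoly]
  have ev : ∀ (a : ℝ) (k : ℕ), (a • tau k) n = a * tau k n := fun a k => by simp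
  simp only [ArithmeticFunction.add_apply, ev]
  ring

/-! ## The sums `Σ_{n<x} τ_j(n)|ν(n)|/n` -/

/-- **`τ_j(n)τ₂(n) ≤ τ_{2j}(n)`**: `τ_j(n)τ₂(n) = Σ_{de=n}τ_j(de) ≤ Σ_{de=n}τ_j(d)τ_j(e) = τ_{2j}(n)` by the
complete sub-multiplicativity of `τ_j` (`MeanSquareMajorant.tau_mul_le`). [cite: Ivic1985, §1.6 (1.68)] -/
theorem tau_mul_tau_two_le (j n : ℕ) : tau j n * tau 2 n ≤ tau (2 * j) n := by
  have h2 : tau 2 n = ∑ x ∈ n.divisorsAntidiagonal, tau 1 x.1 * tau 1 x.2 := tau_add_apply 1 1 n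
  rw [h2, show 2 * j = j + j by ring, tau_add_apply, Finset.mul_sum]
  refine Finset.sum_le_sum fun x hx => ?_
  obtain ⟨hxn, hn0⟩ := Nat.mem_divisorsAntidiagonal.mp hx
  have h1 : x.1 ≠ 0 := by rintro h; rw [h, zero_mul] at hxn; exact hn0 hxn.symm
  have h2' : x.2 ≠ 0 := by rintro h; rw [h, mul_zero] at hxn; exact hn0 hxn.symm
  rw [tau_one_apply h1, tau_one_apply h2', mul_one, mul_one, ← hxn]
  exact tau_mul_le j x.1 x.2

/-- **`Σ_{1≤n<x} τ_j(n)|ν(n)|/n ≤ (1 + log x)^{2j}`** for any `ν` with `|ν(n)| ≤ τ₂(n)` (`n ≥ 1`; e.g.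
`ν = 1∗χ`, (3.1)): `τ_jτ₂ ≤ τ_{2j}` and `Σ_{n≤x}τ_{2j}(n)/n ≤ (1+log x)^{2j}`
(`MeanSquareMajorant.sum_tau_div_Icc_le_log_pow`). [cite: Zhang2022LandauSiegel, §3 (3.1); §17 u007 p.96] -/
theorem sum_tau_mul_norm_le {ν : ℕ → ℂ} (hν : ∀ n : ℕ, n ≠ 0 → ‖ν n‖ ≤ tau 2 n) (j x : ℕ) :
    ∑ n ∈ Ico 1 x, tau j n * ‖ν n‖ / n ≤ (1 + Real.log x) ^ (2 * j) := by
  have h1 : ∑ n ∈ Ico 1 x, tau j n * ‖ν n‖ / n ≤ ∑ n ∈ Ico 1 x, tau (2 * j) n / n := by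
    refine sum_le_sum fun n hn => ?_
    have hn0 : n ≠ 0 := by have := (mem_Ico.mp hn).1; omega
    have hnum : tau j n * ‖ν n‖ ≤ tau (2 * j) n :=
      (mul_le_mul_of_nonneg_left (hν n hn0) (tau_nonneg _ _)).trans (tau_mul_tau_two_le j n)
    exact div_le_div_of_nonneg_right hnum (Nat.cast_nonneg n)
  have h2 : ∑ n ∈ Ico 1 x, tau (2 * j) n / n ≤ ∑ n ∈ Icc 1 x, tau (2 * j) n / n :=
    sum_le_sum_of_subset_of_nonneg (fun n hn => by
      rw [mem_Ico] at hn; rw [mem_Icc]; omega) fun n _ _ => div_nonneg (tau_nonneg _ _) (Nat.cast_nonneg n)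
  exact h1.trans (h2.trans (sum_tau_div_Icc_le_log_pow (2 * j) x))

end Literature.NumberTheory.LFunctions.Zhang2022.U007

end
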